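import Mathlib.Analysis.Analytic.Basic
import Mathlib.Geometry.Manifold.MFDeriv.Basic
import Literature.Geometry.Lorentzian.Stationary
import HarnessLib

/-!
# Chart-free real analyticity of the metric / of a function on a stationary black hole spacetime

Topic `Literature/Geometry/Lorentzian` (namespace `Literature.Geometry.Lorentzian`, dot notation on
`StationaryAFBlackHole`); definition item `defn-StationaryAFBlackHole.IsChartwiseAnalyticAt` of
route `FinalStateConjecture/AnalyticityInvadesErgoregion`, whose six items inline VERBATIM the two
clauses named here (`let An := …`, `let AnF := …`).  Everything is a definition with a body or a
PROVED lemma; no named facts.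

* `𝓑.IsChartwiseAnalyticAt y` — **the metric is real-analytic in some chart of the maximal `C^∞`
  atlas around `y`**: there is `ψ ∈ IsManifold.maximalAtlas (𝓡 4) ∞ 𝓑.carrier` with `y ∈ ψ.source`
  such that every coordinate component `p ↦ g_{ψ⁻¹ p}(dψ⁻¹_p a, dψ⁻¹_p b)` (`a, b ∈ E4`) of the
  pulled-back metric is real-analytic on `ψ.target` (Mathlib `AnalyticOnNhd`).  This is the
  chart-free form of the CONCLUSION of Müller zum Hagen's theorem ("stationary vacuum solutions
  of Einstein's equations are analytic … in suitable (e.g. harmonic) coordinates",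
  [MullerZumHagen1970]) for the smooth (`C^∞`, not `C^ω`) manifolds of the tree, where no analytic
  atlas is available: analyticity is asserted in ONE compatible chart, not in all.
* `𝓑.IsChartwiseAnalyticFunAt u y` — the companion for a function `u : 𝓑.carrier → ℝ`
  (`u ∘ ψ⁻¹` analytic on `ψ.target` for some such `ψ`), the `AnF` clause of item
  `LinearZeroModeAnalyticity`.

API (proved): `isChartwiseAnalyticAt_iff`, `isChartwiseAnalyticFunAt_iff` (`Iff.rfl` with the
inlined clauses); a chart witnessing analyticity at `y` witnesses it on all of its source
(`isChartwiseAnalyticAt_of_mem_source`, `isChartwiseAnalyticFunAt_of_mem_source`), hence **the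
analytic loci `{y | 𝓑.IsChartwiseAnalyticAt y}`, `{y | 𝓑.IsChartwiseAnalyticFunAt u y}` are OPEN**
(`isOpen_setOf_isChartwiseAnalyticAt`, `isOpen_setOf_isChartwiseAnalyticFunAt`); constants are
chartwise analytic (`isChartwiseAnalyticFunAt_const`).

Caveat recorded for users: transition maps of the maximal `C^∞` atlas are only smooth, so the
witnessing chart matters — e.g. `IsChartwiseAnalyticFunAt` is not obviously closed under sums of
functions analytic in DIFFERENT charts.  NOT here: Müller zum Hagen's theorem itself, harmonic /
stationary-adapted coordinates, analytic continuation across the ergosurface (the route's cruxes).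

## References
* H. Müller zum Hagen, *On the analyticity of stationary vacuum solutions of Einstein's
  equation*, Proc. Camb. Phil. Soc. 68 (1970) 199–201. [MullerZumHagen1970]
-/

noncomputable section

open scoped Manifold ContDiff
open Set

universe u

namespace Literature.Geometry.Lorentzian

namespace StationaryAFBlackHole

variable (𝓑 : StationaryAFBlackHole.{u})

/-- **The metric of `𝓑` is real-analytic in some chart of the maximal `C^∞` atlas around `y`**:
some `ψ ∈ maximalAtlas (𝓡 4) ∞` with `y ∈ ψ.source` in which all coordinate components
`p ↦ g(dψ⁻¹ a, dψ⁻¹ b)` of the metric are analytic on `ψ.target` (the conclusion shape of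
Müller zum Hagen 1970, chart-free). Verbatim the `An` clause of route
`FinalStateConjecture/AnalyticityInvadesErgoregion`. [cite: MullerZumHagen1970, Theorem (conclusion: analyticity of the stationary metric in suitable coordinates)] -/
def IsChartwiseAnalyticAt (y : 𝓑.carrier) : Prop :=
  ∃ ψ ∈ IsManifold.maximalAtlas (𝓡 4) ((⊤ : ℕ∞) : WithTop ℕ∞) 𝓑.carrier,
    y ∈ ψ.source ∧ ∀ a b : E4, AnalyticOnNhd ℝ
      (fun p : E4 ↦ 𝓑.metric.val (ψ.symm p) (mfderiv 𝓘(ℝ, E4) (𝓡 4) ψ.symm p a)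
        (mfderiv 𝓘(ℝ, E4) (𝓡 4) ψ.symm p b)) ψ.target

/-- **A function `u` on `𝓑` is real-analytic in some chart of the maximal `C^∞` atlas around `y`**:
`u ∘ ψ⁻¹` is analytic on `ψ.target` for some `ψ ∈ maximalAtlas (𝓡 4) ∞` with `y ∈ ψ.source`.
Verbatim the `AnF` clause of item `LinearZeroModeAnalyticity`. [folklore] -/
def IsChartwiseAnalyticFunAt (u : 𝓑.carrier → ℝ) (y : 𝓑.carrier) : Prop :=
  ∃ ψ ∈ IsManifold.maximalAtlas (𝓡 4) ((⊤ : ℕ∞) : WithTop ℕ∞) 𝓑.carrier,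
    y ∈ ψ.source ∧ AnalyticOnNhd ℝ (u ∘ ψ.symm) ψ.target

variable {𝓑}

/-- Unfolding lemma (`Iff.rfl` with the inlined `An` clause). [folklore] -/
theorem isChartwiseAnalyticAt_iff (y : 𝓑.carrier) :
    𝓑.IsChartwiseAnalyticAt y ↔
      ∃ ψ ∈ IsManifold.maximalAtlas (𝓡 4) ((⊤ : ℕ∞) : WithTop ℕ∞) 𝓑.carrier,
        y ∈ ψ.source ∧ ∀ a b : E4, AnalyticOnNhd ℝ
          (fun p : E4 ↦ 𝓑.metric.val (ψ.symm p) (mfderiv 𝓘(ℝ, E4) (𝓡 4) ψ.symm p a)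
            (mfderiv 𝓘(ℝ, E4) (𝓡 4) ψ.symm p b)) ψ.target :=
  Iff.rfl

/-- Unfolding lemma (`Iff.rfl` with the inlined `AnF` clause). [folklore] -/
theorem isChartwiseAnalyticFunAt_iff (u : 𝓑.carrier → ℝ) (y : 𝓑.carrier) :
    𝓑.IsChartwiseAnalyticFunAt u y ↔
      ∃ ψ ∈ IsManifold.maximalAtlas (𝓡 4) ((⊤ : ℕ∞) : WithTop ℕ∞) 𝓑.carrier,
        y ∈ ψ.source ∧ AnalyticOnNhd ℝ (u ∘ ψ.symm) ψ.target :=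
  Iff.rfl

/-- A chart in which the metric is analytic witnesses `IsChartwiseAnalyticAt` at EVERY point of its
source. [folklore] -/
theorem isChartwiseAnalyticAt_of_mem_source {ψ : OpenPartialHomeomorph 𝓑.carrier E4}
    (hψ : ψ ∈ IsManifold.maximalAtlas (𝓡 4) ((⊤ : ℕ∞) : WithTop ℕ∞) 𝓑.carrier)
    (han : ∀ a b : E4, AnalyticOnNhd ℝ
      (fun p : E4 ↦ 𝓑.metric.val (ψ.symm p) (mfderiv 𝓘(ℝ, E4) (𝓡 4) ψ.symm p a)
        (mfderiv 𝓘(ℝ, E4) (𝓡 4) ψ.symm p b)) ψ.target)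
    {y : 𝓑.carrier} (hy : y ∈ ψ.source) : 𝓑.IsChartwiseAnalyticAt y :=
  ⟨ψ, hψ, hy, han⟩

/-- A chart in which `u` is analytic witnesses `IsChartwiseAnalyticFunAt u` at every point of its
source. [folklore] -/
theorem isChartwiseAnalyticFunAt_of_mem_source {u : 𝓑.carrier → ℝ}
    {ψ : OpenPartialHomeomorph 𝓑.carrier E4}
    (hψ : ψ ∈ IsManifold.maximalAtlas (𝓡 4) ((⊤ : ℕ∞) : WithTop ℕ∞) 𝓑.carrier)
    (han : AnalyticOnNhd ℝ (u ∘ ψ.symm) ψ.target) {y : 𝓑.carrier} (hy : y ∈ ψ.source) :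
    𝓑.IsChartwiseAnalyticFunAt u y :=
  ⟨ψ, hψ, hy, han⟩

/-- **The analytic locus of the metric is open** (the witnessing chart works on all of its open
source). [folklore] -/
theorem isOpen_setOf_isChartwiseAnalyticAt : IsOpen {y : 𝓑.carrier | 𝓑.IsChartwiseAnalyticAt y} := by
  rw [isOpen_iff_forall_mem_open]
  rintro y ⟨ψ, hψ, hy, han⟩
  exact ⟨ψ.source, fun y' hy' => isChartwiseAnalyticAt_of_mem_source hψ han hy', ψ.open_source, hy⟩

/-- **The analytic locus of a function is open.** [folklore] -/
theorem isOpen_setOf_isChartwiseAnalyticFunAt (u : 𝓑.carrier → ℝ) :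
    IsOpen {y : 𝓑.carrier | 𝓑.IsChartwiseAnalyticFunAt u y} := by
  rw [isOpen_iff_forall_mem_open]
  rintro y ⟨ψ, hψ, hy, han⟩
  exact ⟨ψ.source, fun y' hy' => isChartwiseAnalyticFunAt_of_mem_source hψ han hy', ψ.open_source,
    hy⟩

/-- Constant functions are chartwise analytic everywhere (witnessed by the preferred chart at `y`,
which lies in the maximal atlas). [folklore] -/
theorem isChartwiseAnalyticFunAt_const (c : ℝ) (y : 𝓑.carrier) :
    𝓑.IsChartwiseAnalyticFunAt (fun _ => c) y :=
  ⟨chartAt E4 y, IsManifold.chart_mem_maximalAtlas y, mem_chart_source E4 y,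
    fun _ _ => analyticAt_const⟩

/-- `IsChartwiseAnalyticFunAt` only depends on the function (proof-irrelevant restatement helper:
functions agreeing everywhere). [folklore] -/
theorem IsChartwiseAnalyticFunAt.congr {u v : 𝓑.carrier → ℝ} {y : 𝓑.carrier}
    (h : 𝓑.IsChartwiseAnalyticFunAt u y) (huv : ∀ x, u x = v x) : 𝓑.IsChartwiseAnalyticFunAt v y := by
  obtain rfl : u = v := funext huv
  exact h

end StationaryAFBlackHole

end Literature.Geometry.Lorentzian
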